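import Literature.MathematicalPhysics.QuantumLattice.InfiniteVolumeShiftProofs
import Mathlib.Analysis.SpecialFunctions.Trigonometric.Bounds
import HarnessLib

/-!
# Intervals of the chain `ℤ = Site 1`: the block `{1,…,ℓ}`, its translate and its neighbourhood

Trunk **T-QLATTICE**. Bookkeeping for the proof files behind the named fact
`Literature.MathematicalPhysics.QuantumLattice.no_unique_gapped_groundState_halfOddSpin`
(`InfiniteVolume.lean`): the Affleck–Lieb local twist lives on the block `Λ_ℓ = {1, …, ℓ} ⊆ ℤ`
(written `Finset.Icc (1 : Site 1) ℓ` for the product order on `Site 1 = (Fin 1 → ℤ)`), its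
translate by one site is `{2, …, ℓ+1}`, and both, together with the range-`1` neighbourhood
`(Λ_ℓ)_1 = thicken Λ_ℓ 1`, lie in the stage `Λ'_ℓ = {0, …, ℓ+1}` in which all the expectations of
the argument are computed (Tasaki 2022 §3.1: the support of `[Ĥ, Û_{x,ℓ}]`). Contents: membership
and cardinality of such intervals (`Site.mem_Icc_iff`, `Site.card_Icc`, `card_Icc_block`,
`card_Icc_stage`), the inclusions `thicken_Icc_subset`, `Icc_subset_Icc'`, `map_shift_Icc_subset`,
translated regions (`Site.mem_map_shift_iff`, `coe_finsetMapEquiv_shift_symm_apply`), and the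
elementary bound `2 - 2cos t ≤ t²` (`two_sub_two_mul_cos_le_sq`) used for the bond phases.

No statement of any other file is changed and no definition is introduced.

## References

* H. Tasaki, *The Lieb–Schultz–Mattis theorem. A topological point of view*, in: The Physics
  and Mathematics of Elliott Lieb, vol. 2, EMS Press (2022) 405–446, arXiv:2202.06243 (held),
  §3.1 (the local twist `Û_{x,ℓ}` on `[x, x+ℓ]` and the interval `I` of sites whose local
  Hamiltonian meets it). [Tasaki2022]
-/

noncomputable section

open Matrix Complex Finset

namespace Literature.MathematicalPhysics.QuantumLattice

open Literature.Probability.LatticeModels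
open Literature.Probability.LatticeModels (Site box mem_box)

/-! ### Intervals of the chain -/

/-- Membership in an interval of `ℤ = Site 1`, through the single coordinate. [folklore] -/
theorem Site.mem_Icc_iff {a b x : Site 1} : x ∈ Finset.Icc a b ↔ a 0 ≤ x 0 ∧ x 0 ≤ b 0 := by
  rw [Finset.mem_Icc, Pi.le_def, Pi.le_def, Fin.forall_fin_one, Fin.forall_fin_one]

/-- The number of sites of an interval of the chain: `#[a, b] = b + 1 - a`. [folklore] -/
theorem Site.card_Icc (a b : Site 1) : (Finset.Icc a b).card = (b 0 + 1 - a 0).toNat := by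
  rw [Pi.card_Icc, Fin.prod_univ_one, Int.card_Icc]

/-- Membership in a translated region: `y ∈ Λ + v ↔ y - v ∈ Λ`. [folklore] -/
theorem Site.mem_map_shift_iff {d : ℕ} {Λ : Finset (Site d)} {v y : Site d} :
    y ∈ Λ.map (Site.shift v).toEmbedding ↔ y - v ∈ Λ := by
  rw [Finset.mem_map]
  constructor
  · rintro ⟨x, hx, rfl⟩
    simpa using hx
  · intro hy
    exact ⟨y - v, hy, by simp⟩

/-- The inverse of the translation equivalence of regions subtracts the vector:
`↑(e⁻¹ y) = y - v`. [folklore] -/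
theorem coe_finsetMapEquiv_shift_symm_apply {d : ℕ} (Λ : Finset (Site d)) (v : Site d)
    (y : ↥(Λ.map (Site.shift v).toEmbedding)) :
    ((finsetMapEquiv (Site.shift v).toEmbedding Λ).symm y : Site d) = (y : Site d) - v := by
  have h := coe_finsetMapEquiv_apply (Site.shift v).toEmbedding Λ
    ((finsetMapEquiv (Site.shift v).toEmbedding Λ).symm y)
  rw [Equiv.apply_symm_apply, Equiv.coe_toEmbedding, Site.shift_apply] at h
  exact eq_sub_of_add_eq h.symm

/-- `2 - 2cos t ≤ t²` (from `1 - t²/2 ≤ cos t`). [folklore] -/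
theorem two_sub_two_mul_cos_le_sq (t : ℝ) : 2 - 2 * Real.cos t ≤ t ^ 2 := by
  linarith [Real.one_sub_sq_div_two_le_cos (x := t)]

section Chain

variable (ℓ : ℕ)

/-- The `1`-neighbourhood of the block `{1,…,ℓ}` lies in `{0,…,ℓ+1}`. [folklore] -/
theorem thicken_Icc_subset :
    thicken (Finset.Icc (1 : Site 1) (ℓ : Site 1)) 1 ⊆ Finset.Icc (0 : Site 1) ((ℓ : Site 1) + 1) := by
  intro y hy
  simp only [thicken, Finset.mem_biUnion, Finset.mem_image] at hy
  obtain ⟨z, hz, w, hw, rfl⟩ := hy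
  rw [Nat.floor_one, mem_box] at hw
  rw [Site.mem_Icc_iff] at hz ⊢
  simp only [Pi.add_apply, Pi.natCast_apply, Pi.one_apply, Pi.zero_apply, Nat.cast_one] at hz hw ⊢
  have hw0 := hw 0
  constructor <;> omega

/-- The block `{1,…,ℓ}` lies in `{0,…,ℓ+1}`. [folklore] -/
theorem Icc_subset_Icc' :
    Finset.Icc (1 : Site 1) (ℓ : Site 1) ⊆ Finset.Icc (0 : Site 1) ((ℓ : Site 1) + 1) :=
  (subset_thicken _ 1).trans (thicken_Icc_subset ℓ)

/-- The translated block `{2,…,ℓ+1}` lies in `{0,…,ℓ+1}`. [folklore] -/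
theorem map_shift_Icc_subset :
    (Finset.Icc (1 : Site 1) (ℓ : Site 1)).map (Site.shift (1 : Site 1)).toEmbedding ⊆
      Finset.Icc (0 : Site 1) ((ℓ : Site 1) + 1) := by
  intro y hy
  rw [Site.mem_map_shift_iff, Site.mem_Icc_iff] at hy
  rw [Site.mem_Icc_iff]
  simp only [Pi.sub_apply, Pi.add_apply, Pi.natCast_apply, Pi.one_apply, Pi.zero_apply] at hy ⊢
  constructor <;> omega

/-- The block `{1,…,ℓ}` has `ℓ` sites. [folklore] -/
theorem card_Icc_block : (Finset.Icc (1 : Site 1) (ℓ : Site 1)).card = ℓ := by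
  rw [Site.card_Icc]
  simp

/-- The stage `{0,…,ℓ+1}` has `ℓ + 2` sites. [folklore] -/
theorem card_Icc_stage : (Finset.Icc (0 : Site 1) ((ℓ : Site 1) + 1)).card = ℓ + 2 := by
  rw [Site.card_Icc]
  simp only [Pi.add_apply, Pi.natCast_apply, Pi.one_apply, Pi.zero_apply]
  omega

end Chain

end Literature.MathematicalPhysics.QuantumLattice
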